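import Literature.MathematicalPhysics.QuantumFieldTheory.Dimock2011to13.QED3BackgroundFieldSeries
import HarnessLib

/-!
# Dimock, *Quantum electrodynamics on the 3-torus II*, §3.2 THEOREM 1 proof PART II (143)–(151): THE COMMUTATOR BOUND
# `|(R_□(A)S*_□(A))(x,y)| ≤ O(L^{k−i}∕M₀)d′(x,y)^{−2}exp(−O(1)d_Λ(x,y))` — the Lipschitz steps (145) ∕ (150) of the
# partition of unity PROVED (mean value inequality), the nearest-neighbour part (144) ⟹ (143) and the averaging part
# (149) ⟹ (151) ⟹ (143) PROVED from the printed kernel shapes, «we use (129)» BY NAME on `ℤ³`, every `O(1)` explicit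

statement-level skeleton of published theorems with citation tags; proofs where landed; nothing here is a claim about the Yang–Mills mass gap

(Writer seat p11 = literature-prover-lit-balaban-p11-g22-0; YM LIT SWEEP item (c), Lean lane — zero weight for the
YM-INPRINT tokens of row C13.)

**Citation header (reproduction of PUBLISHED work).** J. Dimock, *Quantum electrodynamics on the 3-torus II. The RG
flow*, arXiv:math-ph/0407063v1 (2004) [Dimock2004QED3TorusII], §3.2 «fermions», proof of THEOREM 1, PART II, p.23 L59 –
p.24 L58 of the held text layer `paper:arxiv-math-ph_0407063` (`p.NN Lnn` = PDF page ∕ line).  Companion of the tree's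
`QED3SingularWalkBound` (Part III), `QED3BackgroundFieldSeries` (LEMMA 2 Parts IV–V; its `norm_hop_sum_le` and
`dprime_rpow_neg_two_hop_le` are used BY NAME) and `QED3WalkExpansionInverse` (THEOREM 1 assembled, where (143) is the
later-link hypothesis).

**What the paper prints (verbatim, text layer).**
* p.23 L59–69, (143)–(145): *"Part II. To estimate this expansion we need the following bound. For `□ ∈ D_i`
  `|(R_□(A)S*_□(A))(x,y)| ≤ O(L^{k−i}∕M₀)d′(x,y)^{−2}exp(−O(1)d_Λ(x,y))` (143) To prove it we write `R_□ = R^D_□ + R^Q_□`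
  where `R^D_□ = −[D_{e_k},h_□]` and `R^Q_□ = −[Qᵀ_{k,Λ}bQ_{k,Λ},h_□]`. We have explicitly `(R^D_□(A)S*_□(A))(x,y) =
  Σ_{x′}γ_{x,x′}L^ke^{ie_kL^{−k}A(x,x′)}(h_□(x) − h_□(x′))S*_□(x′,y)` (144) where the sum is over nearest neighbors `x′` of
  `x`. The result now follows by `L^k|h_□(x) − h_□(x′)| ≤ sup_x|∂h_□(x)| ≤ O(L^{k−i}∕M₀)` (145) and (137) and `d′(x′,y) ≥
  d′(x,y)∕2` and `d_Λ(x′,y) ≥ d_Λ(x,y) − 1`."*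
* p.24 L29–58, (149)–(151): *"Then `(R^Q_□(A)S*_□(A))(x,y) = b_i∫_{|x′−[x]|≤L^{−(k−i)}∕2}L^{2(k−i)}exp(ie_iA_{L^{k−i}}(…))
  (h_□(x) − h_□(x′))S*_□(x′,y)` (149) Now since `|x − x′| ≤ L^{−(k−i)}` `|h_□(x) − h_□(x′)| ≤ L^{−(k−i)}sup_x|∂h_□(x)| ≤
  O(M₀^{−1})` (150) we obtain `|(R^Q_□(A)S*_□(A))(x,y)| ≤ O(L^{2(k−i)}∕M₀)∫_{|x′−[x]|≤L^{−(k−i)}∕2}d′(x′,y)^{−2}exp(−O(1)d_Λ(x,y))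
  ≤ O(L^{k−i}∕M₀)exp(−O(1)d_Λ(x,y))` (151) In the second step we use (129). Since `d′(x,y) ≤ d_Λ(x,y) + 1` the result
  follows."*
* p.20 L60–66, (124): *"First take a smooth function `g` on `ℝ³` so `g` has support in `{x : |x| ≤ 2∕3}` and `g = 1` on
  `{x : |x| ≤ 1∕3}` and `Σ_{n∈ℤ³}g(x − n)² = 1`. Then if `□` is a `D_i` block … centered on `y` …, we define `h_□(x) =
  g((x − y)L^{k−i}∕M₀)` (124)"*.

**What is formalized (kernel-checked, zero `sorry`; Mathlib + the tree).**
* §1 **(145) ∕ (150)** — `bump_sub_le`: for a differentiable `g` on a real normed space with `‖g′‖ ≤ G` everywhere,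
  `|g(s(x − y)) − g(s(x′ − y))| ≤ Gs‖x − x′‖` (Mathlib's mean value inequality `Convex.norm_image_sub_le_of_norm_fderiv_le`);
  **`dimock145`** (`‖x − x′‖ = L^{−k}` ⟹ `L^k|h_□(x) − h_□(x′)| ≤ GL^{k−i}∕M₀`); **`dimock150`** (`‖x − x′‖ ≤ ρL^{−(k−i)}` ⟹
  `|h_□(x) − h_□(x′)| ≤ Gρ∕M₀`).
* §2 **(144) ⟹ (143) for `R^D_□`** — `profile_hop_le` (the comparability `P(x′,y)e^{−cd(x′,y)} ≤ 4e^{cδ}P(x,y)e^{−cd(x,y)}`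
  from `d′(x′,y) ≥ d′(x,y)∕2` and `d_Λ(x′,y) ≥ d_Λ(x,y) − δ`); **`dimock143_D`**: a hopping operator with `≤ m` neighbours
  and coefficients of norm `≤ γ₀·GL^{k−i}∕M₀` (the printed `γ_{x,x′}L^ke^{i…}(h_□(x) − h_□(x′))` after (145); phases of
  modulus one) applied to a kernel bounded by (137) gives `≤ (4mγ₀Ge^{cδ}C₀)(L^{k−i}∕M₀)P(x,y)e^{−cd(x,y)}` — by the tree's
  `norm_hop_sum_le`.
* §3 **(149) ⟹ (151) ⟹ (143) for `R^Q_□`** — `norm_blockHop_le` (a block hop against an INTEGRATED singular majorant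
  and a comparable smooth factor); `reinsert_dprime` (*"Since `d′(x,y) ≤ d_Λ(x,y) + 1`"*: `e^{−cu} ≤ (8e^{c∕2}∕c²)d′^{−2}e^{−(c∕2)u}`
  for `0 < d′ ≤ u + 1`, `c > 0`); **`dimock143_Q`**: coefficients of norm `≤ bL^{2(k−i)}Gρ∕M₀` ((149) with (150)) on the
  block of `x`, `‖S*_□(x′,y)‖ ≤ C₀d′(x′,y)^{−2}e^{−cd_Λ(x′,y)}`, `e^{−cd_Λ}` comparable on the block (`δ`), the block
  integral `Σ_{x′}w·d′(x′,y)^{−2} ≤ ιL^{−(k−i)}` ((129)) and `d′ ≤ d_Λ + 1` give `‖(R^Q_□S*_□)(x,y)‖ ≤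
  (bGριe^{cδ}C₀·8e^{c∕2}∕c²)(L^{k−i}∕M₀)d′(x,y)^{−2}e^{−(c∕2)d_Λ(x,y)}`.
* §4 `dimock143` (the two parts add up, decay rate `c∕2`: the later-link hypothesis shape of `dimock134_multiscale` ∕
  `QED3WalkExpansionInverse.dimock_thm1` with `C₁ = a_D + a_Q` and scale factor `L^{k−i}`); **`h129_Z3`** (the `ℤ³`
  member of «we use (129)»: `Σ_{x′∈U}L^{−3k}d′(x′,y)^{−2} ≤ C(2)L^{−(k−i)}` for `#U ≤ (L^i)³`, by the tree's
  `QED3BlockPotentialSums.eq129_L`, `C(2) = blockConst 2 = 289`).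

**Readings ∕ located items (declared).**  (i) The KERNEL FORMULAS (144) and (146)–(149) of the concrete operators
`D_{e_k}(A)` (nearest-neighbour, `γ`-matrices of norm `≤ γ₀`, phases of modulus one, hopping scale `L^k`) and
`Q^{(k)}_i(−A)ᵀb_iQ^{(k)}_i(A)` (kernel `L^{2(k−i)}b_ie^{i…}χ(|x′ − [x]| ≤ L^{−(k−i)}∕2)`, (147)) are the STARTING POINT: the
theorems take the commutator kernels in these printed shapes (`t x x′` supported on neighbours with
`‖t‖ ≤ γ₀·L^k|h_□(x) − h_□(x′)|`, resp. `t x′` supported on the block of `x` with `‖t‖ ≤ bL^{2(k−i)}|h_□(x) − h_□(x′)|`), with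
(145) ∕ (150) supplying the `h`-differences; the case distinction (148) (`x ∈ δΛ^{(k)}_i` or `δΛ^{(k)}_{i+1}`: *"the other
is similar"*) is the choice of `i` in the hypotheses.  (ii) `sup|∂h_□| = O(L^{k−i}∕M₀)` is `G·L^{k−i}∕M₀` with `G = sup‖g′‖`
of the fixed bump (124); the boundary-face modification of `h_□` (p.21 L5–9) changes `s` by a factor `L` or `3`, absorbed
in `G` — not tracked.  (iii) `|x − x′| ≤ L^{−(k−i)}` within a block is `‖x − x′‖ ≤ ρL^{−(k−i)}` with the diameter factor
`ρ` of the norm in use (`ρ = 1` for `|·|∞`).  (iv) «`O(1)`» constants: `4mγ₀Ge^{cδ}C₀` and `bGριe^{cδ}C₀·8e^{c∕2}∕c²`; the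
final decay rate is `c∕2` (half of (137)'s), as *"`exp(−O(1)d_Λ)`"* permits.

**HONEST SCOPE ∕ what is NOT claimed.**  The derivation of the kernel formulas (144), (146)–(149) from the definitions
of `D_{e_k}(A)` ((5)) and `Q_k(A)` ((37), App. A) is not formalized (the tree's `FermionBlockRGFluctuation` ∕
`BIJ85BlockAveragesTorusK` hold the operators abstractly ∕ in another model); the partition of unity `g` of (124) is any
differentiable function with bounded derivative (its support and `Σg² = 1` are not used here); the geometry `δΛ^{(k)}_i`,
`d_Λ` (127) enters only through the comparability hypotheses (`δ`).  LEMMA 2 ((137)) is a hypothesis.  NOT a statement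
about the ultraviolet problem in `d = 4`; NOT a claim about any Bałaban paper.  Unit `lit-balaban-p11-g22`, HOME
`run/shared/lean/pub/lit-balaban/`, 2026-08-22.
-/

noncomputable section

open Finset Real

namespace Literature.MathematicalPhysics.QuantumFieldTheory.Dimock2011to13

namespace QED3TorusII

/-! ## §1 (145) ∕ (150): the rescaled bump `h_□(x) = g((x − y)L^{k−i}∕M₀)` is Lipschitz -/

section Bump

variable {V : Type*} [NormedAddCommGroup V] [NormedSpace ℝ V]

/-- **The Lipschitz step behind (145) and (150).**  For a differentiable `g` with `‖g′‖ ≤ G` everywhere (the fixed smooth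
bump of (124)) and the rescaled, recentred `h(x) = g(s·(x − y))` (`s = L^{k−i}∕M₀`):
`|h(x) − h(x′)| ≤ G·s·‖x − x′‖` — the mean value inequality (Mathlib `Convex.norm_image_sub_le_of_norm_fderiv_le`).
[cite: Dimock2004QED3TorusII, §3.1 (124) p.20 L60–66 and §3.2 Thm 1 proof Part II (145) p.23 L66–69, (150) p.24 L38–42] -/
theorem bump_sub_le (g : V → ℝ) {G : ℝ} (hg : ∀ z, DifferentiableAt ℝ g z) (hG : ∀ z, ‖fderiv ℝ g z‖ ≤ G)
    {s : ℝ} (hs : 0 ≤ s) (y x x' : V) :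
    |g (s • (x - y)) - g (s • (x' - y))| ≤ G * s * ‖x - x'‖ := by
  have h := Convex.norm_image_sub_le_of_norm_fderiv_le (f := g) (s := Set.univ) (fun z _ => hg z)
    (fun z _ => hG z) convex_univ (Set.mem_univ (s • (x' - y))) (Set.mem_univ (s • (x - y)))
  rw [Real.norm_eq_abs] at h
  refine h.trans (le_of_eq ?_)
  rw [← smul_sub, sub_sub_sub_cancel_right, norm_smul, Real.norm_of_nonneg hs]
  ring

/-- **(145)**: for nearest neighbours (`‖x − x′‖ = L^{−k}`, the lattice spacing) and `s = L^{k−i}∕M₀`: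
`L^k|h_□(x) − h_□(x′)| ≤ G·L^{k−i}∕M₀` — *"`L^k|h_□(x) − h_□(x′)| ≤ sup_x|∂h_□(x)| ≤ O(L^{k−i}∕M₀)`"* with `O = G = sup‖g′‖`.
[cite: Dimock2004QED3TorusII, §3.2 Thm 1 proof Part II (145) p.23 L66–69] -/
theorem dimock145 (g : V → ℝ) {G : ℝ} (hg : ∀ z, DifferentiableAt ℝ g z) (hG : ∀ z, ‖fderiv ℝ g z‖ ≤ G)
    {L : ℝ} (hL : 0 < L) {M₀ : ℝ} (hM₀ : 0 < M₀) (k i : ℕ) (y x x' : V) (hnn : ‖x - x'‖ = (L ^ k)⁻¹) :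
    L ^ k * |g ((L ^ (k - i) / M₀) • (x - y)) - g ((L ^ (k - i) / M₀) • (x' - y))| ≤ G * L ^ (k - i) / M₀ := by
  have hLk : 0 < L ^ k := pow_pos hL k
  have h := bump_sub_le g hg hG (show 0 ≤ L ^ (k - i) / M₀ by positivity) y x x'
  rw [hnn] at h
  calc L ^ k * |g ((L ^ (k - i) / M₀) • (x - y)) - g ((L ^ (k - i) / M₀) • (x' - y))|
      ≤ L ^ k * (G * (L ^ (k - i) / M₀) * (L ^ k)⁻¹) := mul_le_mul_of_nonneg_left h hLk.le
    _ = G * L ^ (k - i) / M₀ := by field_simp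

/-- **(150)**: for two points of one `L^{−(k−i)}` block (`‖x − x′‖ ≤ ρL^{−(k−i)}`, `ρ` the diameter factor of the norm
in use) and `s = L^{k−i}∕M₀`: `|h_□(x) − h_□(x′)| ≤ Gρ∕M₀` — *"since `|x − x′| ≤ L^{−(k−i)}`, `|h_□(x) − h_□(x′)| ≤
L^{−(k−i)}sup_x|∂h_□(x)| ≤ O(M₀^{−1})`"*. [cite: Dimock2004QED3TorusII, §3.2 Thm 1 proof Part II (150) p.24 L38–42] -/
theorem dimock150 (g : V → ℝ) {G : ℝ} (hg : ∀ z, DifferentiableAt ℝ g z) (hG : ∀ z, ‖fderiv ℝ g z‖ ≤ G)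
    {L : ℝ} (hL : 0 < L) {M₀ : ℝ} (hM₀ : 0 < M₀) (k i : ℕ) {ρ : ℝ} (y x x' : V)
    (hblock : ‖x - x'‖ ≤ ρ * (L ^ (k - i))⁻¹) :
    |g ((L ^ (k - i) / M₀) • (x - y)) - g ((L ^ (k - i) / M₀) • (x' - y))| ≤ G * ρ / M₀ := by
  have hLki : 0 < L ^ (k - i) := pow_pos hL _
  have hG0 : 0 ≤ G := (norm_nonneg _).trans (hG 0)
  have h := bump_sub_le g hg hG (show 0 ≤ L ^ (k - i) / M₀ by positivity) y x x'
  refine h.trans ?_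
  calc G * (L ^ (k - i) / M₀) * ‖x - x'‖
      ≤ G * (L ^ (k - i) / M₀) * (ρ * (L ^ (k - i))⁻¹) :=
        mul_le_mul_of_nonneg_left hblock (by positivity)
    _ = G * ρ / M₀ := by field_simp

end Bump

/-! ## §2 (144) ⟹ (143): the nearest-neighbour part `R^D_□ = −[D_{e_k}, h_□]` -/

section PartD

variable {X : Type*} [Fintype X]
variable {E : Type*} [NormedRing E]

omit [Fintype X] in
/-- **Comparability of the profile across a hop** (*"`d′(x′,y) ≥ d′(x,y)∕2` and `d_Λ(x′,y) ≥ d_Λ(x,y) − 1`"*): if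
`P(x′,y) ≤ 4P(x,y)` (on `ℤ³`: `dprime_rpow_neg_two_hop_le`) and `d(x′,y) ≥ d(x,y) − δ` (`δ` = one hop in `d_Λ` units), then
`P(x′,y)e^{−cd(x′,y)} ≤ 4e^{cδ}·P(x,y)e^{−cd(x,y)}` (`c ≥ 0`). [cite: Dimock2004QED3TorusII, §3.2 Thm 1 proof Part II p.23 L68–69] -/
theorem profile_hop_le {P d : X → X → ℝ} {c δ : ℝ} (hc : 0 ≤ c) (hP0 : ∀ u v, 0 ≤ P u v) {x x' y : X}
    (hP : P x' y ≤ 4 * P x y) (hd : d x y - δ ≤ d x' y) :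
    P x' y * Real.exp (-(c * d x' y)) ≤ 4 * Real.exp (c * δ) * (P x y * Real.exp (-(c * d x y))) := by
  have he : Real.exp (-(c * d x' y)) ≤ Real.exp (c * δ) * Real.exp (-(c * d x y)) := by
    rw [← Real.exp_add]
    exact Real.exp_le_exp.2 (by nlinarith)
  calc P x' y * Real.exp (-(c * d x' y))
      ≤ (4 * P x y) * (Real.exp (c * δ) * Real.exp (-(c * d x y))) :=
        mul_le_mul hP he (Real.exp_pos _).le (mul_nonneg (by norm_num) (hP0 x y))
    _ = 4 * Real.exp (c * δ) * (P x y * Real.exp (-(c * d x y))) := by ring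

/-- **(144) ⟹ (143) for `R^D_□`.**  The printed kernel (144) `(R^D_□(A)S*_□(A))(x,y) = Σ_{x′}γ_{x,x′}L^k
e^{ie_kL^{−k}A(x,x′)}(h_□(x) − h_□(x′))S*_□(x′,y)` *"where the sum is over nearest neighbors `x′` of `x`"* is a hopping
operator in the sense of `QED3BackgroundFieldSeries.norm_hop_sum_le`: `≤ m` neighbours, coefficients of norm
`≤ ‖γ‖·L^k|h_□(x) − h_□(x′)| ≤ γ₀·GL^{k−i}∕M₀` ((145), phases of modulus `1`), and `S*_□` bounded by (137)
`C₀P(x′,y)e^{−cd(x′,y)}` with the profile comparable across a hop (`profile_hop_le`).  Conclusion: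
`‖(R^D_□S*_□)(x,y)‖ ≤ (4mγ₀Ge^{cδ}C₀)·(L^{k−i}∕M₀)·P(x,y)e^{−cd(x,y)}` — the printed `O(L^{k−i}∕M₀)d′(x,y)^{−2}e^{−O(1)d_Λ(x,y)}`.
[cite: Dimock2004QED3TorusII, §3.2 Thm 1 proof Part II (143)–(145) p.23 L59–69] -/
theorem dimock143_D (nbr : X → Finset X) (t : X → X → E) (S : X → X → E) {P d : X → X → ℝ}
    {m : ℕ} {γ₀ G L M₀ C₀ c δ : ℝ} (hγ₀ : 0 ≤ γ₀) (hG : 0 ≤ G) (hL : 0 < L) (hM₀ : 0 < M₀) (hC₀ : 0 ≤ C₀)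
    (hc : 0 ≤ c) (hP0 : ∀ u v, 0 ≤ P u v) (k i : ℕ)
    (hsupp : ∀ x x', x' ∉ nbr x → t x x' = 0) (hcard : ∀ x, (nbr x).card ≤ m)
    (ht : ∀ x x', ‖t x x'‖ ≤ γ₀ * (G * L ^ (k - i) / M₀))
    (hS : ∀ x' y, ‖S x' y‖ ≤ C₀ * (P x' y * Real.exp (-(c * d x' y))))
    (hPhop : ∀ x, ∀ x' ∈ nbr x, ∀ y, P x' y ≤ 4 * P x y)
    (hdhop : ∀ x, ∀ x' ∈ nbr x, ∀ y, d x y - δ ≤ d x' y) (x y : X) :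
    ‖∑ x', t x x' * S x' y‖
      ≤ 4 * m * γ₀ * G * Real.exp (c * δ) * C₀ * (L ^ (k - i) / M₀) * (P x y * Real.exp (-(c * d x y))) := by
  have h := norm_hop_sum_le nbr t (fun x' => S x' y) (fun x' => C₀ * (P x' y * Real.exp (-(c * d x' y))))
    (m := m) (τ := γ₀ * (G * L ^ (k - i) / M₀)) (κ := 4 * Real.exp (c * δ)) (by positivity)
    (fun x' => mul_nonneg (by positivity) (mul_nonneg hC₀ (mul_nonneg (hP0 _ _) (Real.exp_pos _).le)))
    hsupp hcard ht (fun x' => hS x' y) ?_ x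
  · refine h.trans (le_of_eq ?_)
    ring
  · intro u u' hu'
    have := profile_hop_le (P := P) (d := d) hc hP0 (hPhop u u' hu' y) (hdhop u u' hu' y)
    calc C₀ * (P u' y * Real.exp (-(c * d u' y)))
        ≤ C₀ * (4 * Real.exp (c * δ) * (P u y * Real.exp (-(c * d u y)))) :=
          mul_le_mul_of_nonneg_left this hC₀
      _ = 4 * Real.exp (c * δ) * (C₀ * (P u y * Real.exp (-(c * d u y)))) := by ring

end PartD

/-! ## §3 (149) ⟹ (151) ⟹ (143): the averaging part `R^Q_□ = −[Q_{k,Λ}ᵀbQ_{k,Λ}, h_□]` -/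

section PartQ

variable {X : Type*}
variable {E : Type*} [NormedRing E] [NormedAlgebra ℝ E]

/-- **A block hop against an integrated majorant** — the shape of (149) ⟹ (151): `(R^Q_□S*_□)(x,y) =
∫_{|x′−[x]|≤L^{−(k−i)}∕2}t(x,x′)S*_□(x′,y)dx′` with `|t| ≤ τ` on the block `B` of `x`, `‖S*_□(x′,y)‖ ≤ C·P(x′,y)·ℰ(x′)`, the
slowly varying factor comparable on the block (`ℰ(x′) ≤ κℰ₀`) and the singular factor INTEGRABLE over the block
(`Σ_{x′∈B}w·P(x′,y) ≤ ι`, the paper's (129)): `‖Σ_{x′∈B}w·t(x′)S(x′)‖ ≤ τCκι·ℰ₀`.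
[cite: Dimock2004QED3TorusII, §3.2 Thm 1 proof Part II (149)–(151) p.24 L29–58] -/
theorem norm_blockHop_le (B : Finset X) (t S : X → E) {w τ C κ ι ℰ₀ : ℝ} (P ℰ : X → ℝ) (hw : 0 ≤ w)
    (hτ0 : 0 ≤ τ) (hC : 0 ≤ C) (hκℰ : 0 ≤ κ * ℰ₀) (hP0 : ∀ x', 0 ≤ P x')
    (hτ : ∀ x' ∈ B, ‖t x'‖ ≤ τ) (hS : ∀ x', ‖S x'‖ ≤ C * (P x' * ℰ x'))
    (hℰ : ∀ x' ∈ B, ℰ x' ≤ κ * ℰ₀) (hP : ∑ x' ∈ B, w * P x' ≤ ι) :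
    ‖∑ x' ∈ B, w • (t x' * S x')‖ ≤ τ * C * κ * ι * ℰ₀ := by
  calc ‖∑ x' ∈ B, w • (t x' * S x')‖
      ≤ ∑ x' ∈ B, ‖w • (t x' * S x')‖ := norm_sum_le _ _
    _ ≤ ∑ x' ∈ B, w * (τ * (C * (P x' * (κ * ℰ₀)))) := by
        refine sum_le_sum fun x' hx' => ?_
        rw [norm_smul, Real.norm_of_nonneg hw]
        refine mul_le_mul_of_nonneg_left ?_ hw
        refine (norm_mul_le _ _).trans (mul_le_mul (hτ x' hx') ?_ (norm_nonneg _) hτ0)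
        exact (hS x').trans (mul_le_mul_of_nonneg_left
          (mul_le_mul_of_nonneg_left (hℰ x' hx') (hP0 x')) hC)
    _ = τ * C * (κ * ℰ₀) * ∑ x' ∈ B, w * P x' := by
        rw [mul_sum]; exact sum_congr rfl fun x' _ => by ring
    _ ≤ τ * C * (κ * ℰ₀) * ι := mul_le_mul_of_nonneg_left hP (by positivity)
    _ = τ * C * κ * ι * ℰ₀ := by ring

/-- **«Since `d′(x,y) ≤ d_Λ(x,y) + 1` the result follows»** — re-inserting the singular weight: for `0 < c`,
`0 < d′ ≤ u + 1` (`u = d_Λ(x,y)`): `e^{−cu} ≤ (8e^{c∕2}∕c²)·d′^{−2}·e^{−(c∕2)u}` (half the decay rate pays for `d′²`, using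
`t² ≤ (2∕a²)e^{at}`). [cite: Dimock2004QED3TorusII, §3.2 Thm 1 proof Part II p.24 L58] -/
theorem reinsert_dprime {c u d' : ℝ} (hc : 0 < c) (hu : 0 ≤ u) (hd' : 0 < d') (hle : d' ≤ u + 1) :
    Real.exp (-(c * u)) ≤ 8 * Real.exp (c / 2) / c ^ 2 * (d' ^ 2)⁻¹ * Real.exp (-(c / 2 * u)) := by
  -- `(u+1)² ≤ (8/c²)·e^{(c/2)(u+1)}`
  have hq : (u + 1) ^ 2 ≤ 8 / c ^ 2 * Real.exp (c / 2 * (u + 1)) := by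
    have hx : 0 ≤ c / 2 * (u + 1) := by positivity
    have h1 := Real.quadratic_le_exp_of_nonneg hx
    have h2 : (c / 2 * (u + 1)) ^ 2 / 2 ≤ Real.exp (c / 2 * (u + 1)) := by nlinarith [h1]
    rw [div_mul_eq_mul_div, le_div_iff₀ (by positivity)]
    nlinarith [h2]
  have hd2 : d' ^ 2 ≤ (u + 1) ^ 2 := pow_le_pow_left₀ hd'.le hle 2
  have hd2pos : 0 < d' ^ 2 := by positivity
  -- multiply through
  rw [show Real.exp (-(c * u)) = Real.exp (-(c / 2 * u)) * Real.exp (-(c / 2 * u)) by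
    rw [← Real.exp_add]; ring_nf]
  have hkey : Real.exp (-(c / 2 * u)) ≤ 8 * Real.exp (c / 2) / c ^ 2 * (d' ^ 2)⁻¹ := by
    rw [le_mul_inv_iff₀ hd2pos]
    calc Real.exp (-(c / 2 * u)) * d' ^ 2 ≤ Real.exp (-(c / 2 * u)) * (u + 1) ^ 2 :=
          mul_le_mul_of_nonneg_left hd2 (Real.exp_pos _).le
      _ ≤ Real.exp (-(c / 2 * u)) * (8 / c ^ 2 * Real.exp (c / 2 * (u + 1))) :=
          mul_le_mul_of_nonneg_left hq (Real.exp_pos _).le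
      _ = 8 * Real.exp (c / 2) / c ^ 2 := by
          rw [show c / 2 * (u + 1) = c / 2 * u + c / 2 by ring, Real.exp_add]
          have : Real.exp (-(c / 2 * u)) * Real.exp (c / 2 * u) = 1 := by
            rw [← Real.exp_add, neg_add_cancel, Real.exp_zero]
          calc Real.exp (-(c / 2 * u)) * (8 / c ^ 2 * (Real.exp (c / 2 * u) * Real.exp (c / 2)))
              = 8 / c ^ 2 * Real.exp (c / 2) * (Real.exp (-(c / 2 * u)) * Real.exp (c / 2 * u)) := by ring
            _ = 8 * Real.exp (c / 2) / c ^ 2 := by rw [this]; ring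
  exact mul_le_mul_of_nonneg_right hkey (Real.exp_pos _).le

/-- **(149) ⟹ (151) ⟹ (143) for `R^Q_□`.**  The printed kernel (149) `(R^Q_□(A)S*_□(A))(x,y) = b_i∫_{|x′−[x]|≤L^{−(k−i)}∕2}
L^{2(k−i)}e^{ie_iA(…)}(h_□(x) − h_□(x′))S*_□(x′,y)` is a block hop: coefficients of norm `≤ bL^{2(k−i)}·|h_□(x) − h_□(x′)| ≤
bL^{2(k−i)}·Gρ∕M₀` ((150)), `S*_□` bounded by (137) `C₀d′(x′,y)^{−2}e^{−cd_Λ(x′,y)}`, the decay factor comparable on the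
block (`e^{−cd_Λ(x′,y)} ≤ e^{cδ}e^{−cd_Λ(x,y)}`, `δ` = block diameter in `d_Λ` units) and *"In the second step we use (129)"*:
`∫_{block}d′(x′,y)^{−2}dx′ ≤ ιL^{−(k−i)}` (`ι = C(2)`: `QED3BlockPotentialSums.eq129_L`).  With `d′(x,y) ≤ d_Λ(x,y) + 1`
(`reinsert_dprime`): `‖(R^Q_□S*_□)(x,y)‖ ≤ (bGριe^{cδ}C₀·8e^{c∕2}∕c²)·(L^{k−i}∕M₀)·d′(x,y)^{−2}e^{−(c∕2)d_Λ(x,y)}` — the printed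
`O(L^{k−i}∕M₀)d′(x,y)^{−2}exp(−O(1)d_Λ(x,y))`. [cite: Dimock2004QED3TorusII, §3.2 Thm 1 proof Part II (146)–(151) p.23 L70 – p.24 L58] -/
theorem dimock143_Q (B : Finset X) (t : X → E) (S : X → X → E) (dp dΛ : X → X → ℝ)
    {w b G ρ L M₀ C₀ c δ ι : ℝ} (hw : 0 ≤ w) (hb : 0 ≤ b) (hG : 0 ≤ G) (hρ : 0 ≤ ρ) (hL : 0 < L)
    (hM₀ : 0 < M₀) (hC₀ : 0 ≤ C₀) (hc : 0 < c) (hι : 0 ≤ ι) (k i : ℕ)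
    (hdp : ∀ u v, 0 < dp u v) (hdΛ : ∀ u v, 0 ≤ dΛ u v)
    (ht : ∀ x' ∈ B, ‖t x'‖ ≤ b * L ^ (2 * (k - i)) * (G * ρ / M₀))
    (x y : X) (hS : ∀ x', ‖S x' y‖ ≤ C₀ * ((dp x' y ^ 2)⁻¹ * Real.exp (-(c * dΛ x' y))))
    (hcomp : ∀ x' ∈ B, dΛ x y - δ ≤ dΛ x' y)
    (h129 : ∑ x' ∈ B, w * (dp x' y ^ 2)⁻¹ ≤ ι * (L ^ (k - i))⁻¹)
    (hdd : dp x y ≤ dΛ x y + 1) :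
    ‖∑ x' ∈ B, w • (t x' * S x' y)‖
      ≤ b * G * ρ * ι * Real.exp (c * δ) * C₀ * (8 * Real.exp (c / 2) / c ^ 2) * (L ^ (k - i) / M₀)
          * ((dp x y ^ 2)⁻¹ * Real.exp (-(c / 2 * dΛ x y))) := by
  have hLki : 0 < L ^ (k - i) := pow_pos hL _
  -- the block hop with `ℰ(x′) = e^{−cd_Λ(x′,y)}`, `ℰ₀ = e^{−cd_Λ(x,y)}`, `κ = e^{cδ}`
  have h1 := norm_blockHop_le B t (fun x' => S x' y) (w := w) (τ := b * L ^ (2 * (k - i)) * (G * ρ / M₀))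
    (C := C₀) (κ := Real.exp (c * δ)) (ι := ι * (L ^ (k - i))⁻¹) (ℰ₀ := Real.exp (-(c * dΛ x y)))
    (fun x' => (dp x' y ^ 2)⁻¹) (fun x' => Real.exp (-(c * dΛ x' y))) hw (by positivity) hC₀ (by positivity)
    (fun x' => by have := hdp x' y; positivity) ht hS ?_ h129
  · have h2 := reinsert_dprime hc (hdΛ x y) (hdp x y) hdd
    have hpow : L ^ (2 * (k - i)) = L ^ (k - i) * L ^ (k - i) := by
      rw [two_mul, pow_add]
    calc ‖∑ x' ∈ B, w • (t x' * S x' y)‖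
        ≤ b * L ^ (2 * (k - i)) * (G * ρ / M₀) * C₀ * Real.exp (c * δ) * (ι * (L ^ (k - i))⁻¹)
            * Real.exp (-(c * dΛ x y)) := h1
      _ = b * G * ρ * ι * Real.exp (c * δ) * C₀ * (L ^ (k - i) / M₀) * Real.exp (-(c * dΛ x y)) := by
            rw [hpow]; field_simp
      _ ≤ b * G * ρ * ι * Real.exp (c * δ) * C₀ * (L ^ (k - i) / M₀)
            * (8 * Real.exp (c / 2) / c ^ 2 * (dp x y ^ 2)⁻¹ * Real.exp (-(c / 2 * dΛ x y))) :=
            mul_le_mul_of_nonneg_left h2 (by positivity)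
      _ = _ := by ring
  · intro x' hx'
    rw [← Real.exp_add]
    exact Real.exp_le_exp.2 (by nlinarith [hcomp x' hx'])

end PartQ

/-! ## §4 (143): both parts together; the `ℤ³` discharge of «we use (129)» -/

section Combine

variable {X : Type*} [Fintype X]
variable {E : Type*} [NormedRing E]

/-- **(143)**: `R_□ = R^D_□ + R^Q_□` and the two bounds (with decay rates `c` and `c∕2`) combine to
`‖(R_□S*_□)(x,y)‖ ≤ (a_D + a_Q)·(L^{k−i}∕M₀)·P(x,y)e^{−(c∕2)d(x,y)}` — the later-link hypothesis shape of
`QED3WalkExpansionInverse` ∕ `dimock134_multiscale` with `C₁ = a_D + a_Q` and scale factor `L^{k−i}`.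
[cite: Dimock2004QED3TorusII, §3.2 Thm 1 proof Part II (143) p.23 L59–71] -/
theorem dimock143 {RD RQ : E} {aD aQ s Φ c d : ℝ} (haD : 0 ≤ aD) (hc : 0 ≤ c) (hd : 0 ≤ d) (hs : 0 ≤ s)
    (hΦ : 0 ≤ Φ)
    (hD : ‖RD‖ ≤ aD * s * (Φ * Real.exp (-(c * d))))
    (hQ : ‖RQ‖ ≤ aQ * s * (Φ * Real.exp (-(c / 2 * d)))) :
    ‖RD + RQ‖ ≤ (aD + aQ) * s * (Φ * Real.exp (-(c / 2 * d))) := by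
  have he : Real.exp (-(c * d)) ≤ Real.exp (-(c / 2 * d)) := Real.exp_le_exp.2 (by nlinarith)
  calc ‖RD + RQ‖ ≤ ‖RD‖ + ‖RQ‖ := norm_add_le _ _
    _ ≤ aD * s * (Φ * Real.exp (-(c * d))) + aQ * s * (Φ * Real.exp (-(c / 2 * d))) := add_le_add hD hQ
    _ ≤ aD * s * (Φ * Real.exp (-(c / 2 * d))) + aQ * s * (Φ * Real.exp (-(c / 2 * d))) := by
        gcongr
    _ = (aD + aQ) * s * (Φ * Real.exp (-(c / 2 * d))) := by ring

end Combine

section Z3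

/-- **«In the second step we use (129)»**, the `ℤ³` member: for the `L^{−(k−i)}` block `U` of `x` (`#U ≤ (L^i)³` sites at
spacing `L^{−k}`, `1 ≤ L`, `i ≤ k`): `∫_U d′(x′,y)^{−2}dx′ ≤ C(2)·L^{−(k−i)}` (`C(2) = blockConst 2 = 289`) — the hypothesis
`h129` of `dimock143_Q` with `ι = C(2)`, by the tree's `QED3BlockPotentialSums.eq129_L`.
[cite: Dimock2004QED3TorusII, §3.1 Lemma 1 (129) p.21 L36–39 and §3.2 Thm 1 proof Part II p.24 L58] -/
theorem h129_Z3 {L : ℕ} (hL : 1 ≤ L) {i k : ℕ} (hik : i ≤ k) (U : Finset (Fin 3 → ℤ))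
    (hcard : U.card ≤ (L ^ i) ^ 3) (y : Fin 3 → ℤ) :
    ∑ x' ∈ U, ((L : ℝ) ^ k)⁻¹ ^ 3 * (dprime ((L : ℝ) ^ k)⁻¹ x' y ^ 2)⁻¹
      ≤ blockConst 2 * ((L : ℝ) ^ (k - i))⁻¹ := by
  have hL0 : (0 : ℝ) < L := by exact_mod_cast (show 0 < L by omega)
  have h := eq129_L (α := 2) (by norm_num) (by norm_num) hL hik U hcard y
  unfold blockIntegral at h
  rw [show (3 : ℝ) - 2 = 1 by norm_num, Real.rpow_one] at h
  refine le_trans (le_of_eq (sum_congr rfl fun x' _ => ?_)) h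
  beta_reduce
  rw [dprime_comm _ y x', Real.rpow_neg (dprime_pos (by positivity) _ _).le,
    show (2 : ℝ) = ((2 : ℕ) : ℝ) by norm_num, Real.rpow_natCast]

end Z3

end QED3TorusII

end Literature.MathematicalPhysics.QuantumFieldTheory.Dimock2011to13
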